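import Mathlib.Analysis.Fourier.FourierTransform
import Mathlib.MeasureTheory.Function.LpSeminorm.Basic
import Mathlib.Analysis.SpecialFunctions.Pow.Real
import HarnessLib

/-!
# The fractal uncertainty principle for `ν`-porous sets
# (Bourgain–Dyatlov 2018 via Dyatlov–Jin–Nonnenmacher 2021, Proposition 2.9)

Topic `Literature/Analysis/Fourier`. Ledger item `wi-19857` (route QuantumAdvantage/AreaUncertainty,
crux `PorousFUP` = stmt-QuantumAdvantage-9607, whose DISCRETE `ℤ/N` statement is not in print; this
file records the CONTINUUM input). Companion of `FractalUncertaintyPrinciple.lean` (Bourgain–Dyatlov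
2018, Theorem 4, for `δ`-regular sets: `IsRegularSet`, `bourgainDyatlov2018_thm4`), which deliberately
left out porosity and the semiclassical Fourier transform `𝓕_h`; both are supplied here.

Sources (read from the materialised texts): S. Dyatlov, L. Jin, S. Nonnenmacher, *Control of
eigenfunctions on surfaces of variable curvature*, J. Amer. Math. Soc. 35 (2022) = arXiv:1906.08923,
§2.4 "Fractal uncertainty principle" (Definition 2.8, Proposition 2.9, Lemma 2.11)
[`DyatlovJinNonnenmacher2021`]; S. Dyatlov, *An introduction to fractal uncertainty principle*,
J. Math. Phys. 60 (2019) 081505 = arXiv:1903.02599, §2 ((2.1): `𝓕_h`; Definition 3: porosity;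
Proposition 1: regular vs porous; Theorem 3: FUP for porous sets) [`Dyatlov2019`]; J. Bourgain,
S. Dyatlov, Ann. of Math. 187 (2018), Theorem 4 [`BourgainDyatlov2018`].

## Contents

Definitions (with bodies):
* `IsPorousOnScales X ν α₀ α₁` — DJN Definition 2.8 / Dyatlov 2019 Definition 3: every interval
  `I = [a, b]` with `α₀ ≤ |I| ≤ α₁` contains an interval `J = [c, d] ⊆ I` with `|J| = ν |I|` and
  `J ∩ X = ∅`;
* `fourierSemiclassical h f ξ = 𝓕_h f(ξ) = (2πh)^{-1/2} ∫ e^{-ixξ/h} f(x) dx` — the unitary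
  semiclassical Fourier transform (DJN (2.32); Dyatlov 2019 (2.1)), written as the printed integral.

Named fact (D-0014; nothing asserted):
* `dyatlovJinNonnenmacher2021_prop_2_9` — **FUP for `ν`-porous sets** (DJN Proposition 2.9, "a
  version of [Bourgain–Dyatlov 2018] adapted to unbounded `ν`-porous sets"): for each `ν ∈ (0,1)`
  there are `β = β(ν) > 0` and `C = C(ν) > 0` with `‖𝟙_{Ω₋} 𝓕_h 𝟙_{Ω₊}‖_{L²(ℝ)→L²(ℝ)} ≤ C h^β` for all
  `0 < h ≤ 1` and all `Ω± ⊆ ℝ` that are `ν`-porous on scales `h` to `1`.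

PROVED:
* API of porosity: monotonicity in the set, in `ν`, and in the range of scales
  (`IsPorousOnScales.mono`, `.of_le`, `.anti`), the empty set (`ν ≤ 1`), a point (`ν < 1/2`,
  non-vacuity), and: for `ν > 1` no set is porous on a usable range of scales (`not_of_one_lt`);
* **DJN Lemma 2.11** (neighbourhoods of porous sets are porous): if `Ω` is `ν`-porous on scales
  `α₀` to `α₁` then `Ω + [-α₂, α₂]` is `(ν/3)`-porous on scales `max(α₀, 3α₂/ν)` to `α₁`
  (`IsPorousOnScales.thickening`) — proved verbatim after the source;
* the survey's form, Dyatlov 2019 Theorem 3 (`X, Y ⊆ [0,1]`, `0 < h < 1`), as a corollary of the fact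
  (`dyatlov2019_thm3_of`).

## Faithfulness notes

* Operator norm → quadratic form. `‖𝟙_X 𝓕_h 𝟙_Y‖_{L²→L²} ≤ C h^β` is rendered on the dense class
  `L¹ ∩ L²` of `L²(Y)`: for every `u ∈ L¹(ℝ) ∩ L²(ℝ)` vanishing off `Y`,
  `∫_X |𝓕_h u|² ≤ (C h^β)² ∫ |u|²` (for such `u` the printed integral `𝓕_h u(ξ)` converges absolutely
  and is a bounded continuous function of `ξ`; the bound on the dense class is equivalent to the
  operator-norm bound since `𝟙_X 𝓕_h 𝟙_Y` is bounded on `L²`). `X` and `Y` are taken measurable (the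
  source's multiplication operators `𝟙_Ω` presuppose it); no closedness is assumed (DJN Def. 2.8 is
  for arbitrary subsets; Dyatlov 2019 Def. 3 asks `X` closed).
* `ν ∈ (0,1)` as in DJN (for `ν > 1` nothing is porous on a usable range of scales,
  `IsPorousOnScales.not_of_one_lt`); `β, C` depend only on `ν`; the sets may be unbounded;
  `0 < h ≤ 1`.
* An explicit admissible exponent, `β(ν) = exp(-exp(exp(K/ν³)))` (Jin–Zhang 2020, as quoted after
  DJN Prop. 2.9), and the porous-to-regular step (Dyatlov 2019 Prop. 1(2); DJN proof of Prop. 2.9,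
  Step 4) are NOT vendored: the fact below is the printed end result.

## References

* [DyatlovJinNonnenmacher2021] S. Dyatlov, L. Jin, S. Nonnenmacher, J. Amer. Math. Soc. 35 (2022),
  361–465 = arXiv:1906.08923: §2.4, Def. 2.8, (2.32), Prop. 2.9, Prop. 2.10, Lemma 2.11.
* [Dyatlov2019] S. Dyatlov, J. Math. Phys. 60 (2019), 081505 = arXiv:1903.02599: §2.1 (2.1)–(2.2),
  Def. 1; §2.2 Def. 2, Def. 3, Prop. 1, Prop. 2; §2.3 Thm. 1 (= BD18), Thm. 2, Thm. 3.
* [BourgainDyatlov2018] J. Bourgain, S. Dyatlov, Ann. of Math. 187 (2018), 825–867, Theorem 4 —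
  vendored in `FractalUncertaintyPrinciple.lean` (`bourgainDyatlov2018_thm4`).
-/

noncomputable section

open _root_.MeasureTheory Set Real

namespace Literature.Analysis.Fourier

/-! ## Porous sets -/

/-- `IsPorousOnScales X ν α₀ α₁`: the set `X ⊆ ℝ` is `ν`-POROUS ON SCALES `α₀` TO `α₁` — for every
interval `I = [a, b]` (`a < b`) of size `|I| = b - a ∈ [α₀, α₁]` there is a subinterval
`J = [c, d] ⊆ I` of size `|J| = ν |I|` with `J ∩ X = ∅`. [cite: DyatlovJinNonnenmacher2021, Definition 2.8] [cite: Dyatlov2019, §2.2 Definition 3] -/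
def IsPorousOnScales (X : Set ℝ) (ν α₀ α₁ : ℝ) : Prop :=
  ∀ a b : ℝ, a < b → α₀ ≤ b - a → b - a ≤ α₁ →
    ∃ c d : ℝ, a ≤ c ∧ d ≤ b ∧ d - c = ν * (b - a) ∧ Disjoint (Icc c d) X

namespace IsPorousOnScales

variable {X Y : Set ℝ} {ν ν' α₀ α₁ α₀' α₁' : ℝ}

/-- Subsets of porous sets are porous (same `ν`, same scales). [folklore] -/
theorem mono (h : IsPorousOnScales X ν α₀ α₁) (hYX : Y ⊆ X) : IsPorousOnScales Y ν α₀ α₁ := by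
  intro a b hab h0 h1
  obtain ⟨c, d, hac, hdb, hdc, hdisj⟩ := h a b hab h0 h1
  exact ⟨c, d, hac, hdb, hdc, hdisj.mono_right hYX⟩

/-- Shrinking the range of scales preserves porosity. [folklore] -/
theorem anti (h : IsPorousOnScales X ν α₀ α₁) (h0 : α₀ ≤ α₀') (h1 : α₁' ≤ α₁) :
    IsPorousOnScales X ν α₀' α₁' :=
  fun a b hab ha hb => h a b hab (h0.trans ha) (hb.trans h1)

/-- Decreasing `ν` preserves porosity: shrink the pore `[c, d]` to `[c, c + ν'(b - a)]`. [cite: Dyatlov2019, §2.2 (remark after Definition 3: "the precise value of ν will typically not be of importance")] -/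
theorem of_le (h : IsPorousOnScales X ν α₀ α₁) (hle : ν' ≤ ν) :
    IsPorousOnScales X ν' α₀ α₁ := by
  intro a b hab h0 h1
  obtain ⟨c, d, hac, hdb, hdc, hdisj⟩ := h a b hab h0 h1
  refine ⟨c, c + ν' * (b - a), hac, ?_, by ring, ?_⟩
  · have : ν' * (b - a) ≤ ν * (b - a) := mul_le_mul_of_nonneg_right hle (sub_pos.2 hab).le
    linarith
  · refine hdisj.mono_left (Icc_subset_Icc le_rfl ?_)
    have : ν' * (b - a) ≤ ν * (b - a) := mul_le_mul_of_nonneg_right hle (sub_pos.2 hab).le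
    linarith

/-- The empty set is `ν`-porous on all scales for `ν ≤ 1`. [folklore] -/
theorem empty (hν1 : ν ≤ 1) (α₀ α₁ : ℝ) : IsPorousOnScales (∅ : Set ℝ) ν α₀ α₁ := by
  intro a b hab _ _
  refine ⟨a, a + ν * (b - a), le_rfl, ?_, by ring, disjoint_empty _⟩
  have : ν * (b - a) ≤ 1 * (b - a) := mul_le_mul_of_nonneg_right hν1 (sub_pos.2 hab).le
  linarith

/-- **Non-vacuity:** a point is `ν`-porous on all scales for `ν < 1/2` (of the two end intervals of
length `ν|I|` of `I`, at least one misses the point). [folklore] -/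
theorem singleton (x₀ : ℝ) (hν : ν < 1 / 2) (α₀ α₁ : ℝ) :
    IsPorousOnScales ({x₀} : Set ℝ) ν α₀ α₁ := by
  intro a b hab _ _
  by_cases hx : x₀ ∈ Icc a (a + ν * (b - a))
  · refine ⟨b - ν * (b - a), b, by nlinarith [sub_pos.2 hab], le_rfl, by ring, ?_⟩
    rw [Set.disjoint_singleton_right, mem_Icc, not_and_or]
    left
    have h1 : (1 - 2 * ν) * (b - a) > 0 := mul_pos (by linarith) (sub_pos.2 hab)
    intro hle
    have := hx.2
    nlinarith
  · exact ⟨a, a + ν * (b - a), le_rfl, by nlinarith [sub_pos.2 hab], by ring,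
      Set.disjoint_singleton_right.2 hx⟩

/-- For `ν > 1` NO set is `ν`-porous on a usable range of scales (`α₀ ≤ α₁`, `0 < α₁`), not even
`∅`: a pore longer than the interval cannot fit inside it. (This is why the sources take
`ν ∈ (0, 1)`.) [folklore] -/
theorem not_of_one_lt (hν : 1 < ν) (h01 : α₀ ≤ α₁) (h1 : 0 < α₁) : ¬ IsPorousOnScales X ν α₀ α₁ := by
  intro h
  -- any interval of admissible positive length `ℓ` gives a contradiction `ν ℓ ≤ ℓ`
  set ℓ : ℝ := max α₀ (α₁ / 2) with hℓ
  have hℓpos : 0 < ℓ := lt_max_of_lt_right (by positivity)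
  have hℓ0 : α₀ ≤ ℓ := le_max_left _ _
  have hℓ1 : ℓ ≤ α₁ := max_le h01 (by linarith)
  obtain ⟨c, d, hac, hdb, hdc, -⟩ := h 0 ℓ hℓpos (by simpa using hℓ0) (by simpa using hℓ1)
  have h2 : d - c ≤ ℓ := by linarith
  have h3 : ℓ < ν * ℓ := lt_mul_left hℓpos hν
  have h4 : d - c = ν * ℓ := by rw [hdc, sub_zero]
  linarith

/-- **Neighbourhoods of porous sets are porous** (Dyatlov–Jin–Nonnenmacher 2021, Lemma 2.11; Dyatlov
2019, Proposition 2(2) is the case `α₀ = 0`, `α₁ = 1`). Let `ν ∈ (0,1)`, `0 < α₀ ≤ α₁` and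
`0 < α₂ ≤ (ν/3) α₁`. If `Ω` is `ν`-porous on scales `α₀` to `α₁` then the neighbourhood
`Ω(α₂) = Ω + [-α₂, α₂] = {x : ∃ y ∈ Ω, |x - y| ≤ α₂}` is `(ν/3)`-porous on scales `max(α₀, 3α₂/ν)` to
`α₁`. Proof as printed: a pore `J ⊆ I` of `Ω` with `|J| = ν|I| ≥ 3α₂` has middle third `J'` with
`J'(α₂) ⊆ J`, so `J' ∩ Ω(α₂) = ∅`. (Of the printed hypotheses `ν ∈ (0,1)`, `0 < α₀ ≤ α₁`,
`0 < α₂ ≤ (ν/3)α₁` only `0 < ν` is needed for the implication; the others make the range of scales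
nonempty.) [cite: DyatlovJinNonnenmacher2021, Lemma 2.11] [cite: Dyatlov2019, §2.2 Proposition 2(2)] -/
theorem thickening {Ω : Set ℝ} {ν α₀ α₁ α₂ : ℝ} (hν : 0 < ν) (h : IsPorousOnScales Ω ν α₀ α₁) :
    IsPorousOnScales {x : ℝ | ∃ y ∈ Ω, |x - y| ≤ α₂} (ν / 3) (max α₀ (3 / ν * α₂)) α₁ := by
  intro a b hab h0 h1
  obtain ⟨c, d, hac, hdb, hdc, hdisj⟩ := h a b hab ((le_max_left _ _).trans h0) h1
  -- the pore `[c, d]` has length `ν (b - a) ≥ 3 α₂`; take its middle third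
  have hlen : 3 * α₂ ≤ ν * (b - a) := by
    have h3 : 3 / ν * α₂ ≤ b - a := (le_max_right _ _).trans h0
    have := mul_le_mul_of_nonneg_left h3 hν.le
    calc 3 * α₂ = ν * (3 / ν * α₂) := by field_simp
      _ ≤ ν * (b - a) := this
  refine ⟨c + ν / 3 * (b - a), c + 2 * (ν / 3) * (b - a), by nlinarith [sub_pos.2 hab], ?_, by ring,
    ?_⟩
  · nlinarith [sub_pos.2 hab]
  · rw [Set.disjoint_left]
    rintro x ⟨hx1, hx2⟩ ⟨y, hy, hxy⟩
    have hyJ : y ∈ Icc c d := by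
      rw [abs_le] at hxy
      constructor <;> nlinarith [sub_pos.2 hab]
    exact Set.disjoint_left.1 hdisj hyJ hy

end IsPorousOnScales

/-! ## The semiclassical Fourier transform -/

/-- The unitary SEMICLASSICAL FOURIER TRANSFORM `𝓕_h f(ξ) = (2πh)^{-1/2} ∫_ℝ e^{-ixξ/h} f(x) dx`
(`h > 0` the semiclassical parameter), written as the printed integral; for `f ∈ L¹(ℝ)` it converges
absolutely. (In terms of Mathlib's `𝓕 f(w) = ∫ e^{-2πixw} f(x) dx`:
`𝓕_h f(ξ) = (2πh)^{-1/2} 𝓕 f(ξ/(2πh))`.) [cite: DyatlovJinNonnenmacher2021, §2.4 (2.32)] [cite: Dyatlov2019, §2.1 (2.1)] -/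
def fourierSemiclassical (h : ℝ) (f : ℝ → ℂ) (ξ : ℝ) : ℂ :=
  (((2 * π * h) ^ (-(1 / 2 : ℝ)) : ℝ) : ℂ) *
    ∫ x : ℝ, Complex.exp (-(Complex.I * (x : ℂ) * (ξ : ℂ) / (h : ℂ))) * f x

/-- Unfolding lemma for `fourierSemiclassical`. [folklore] -/
theorem fourierSemiclassical_apply (h : ℝ) (f : ℝ → ℂ) (ξ : ℝ) :
    fourierSemiclassical h f ξ = (((2 * π * h) ^ (-(1 / 2 : ℝ)) : ℝ) : ℂ) *
      ∫ x : ℝ, Complex.exp (-(Complex.I * (x : ℂ) * (ξ : ℂ) / (h : ℂ))) * f x := rfl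

/-- `𝓕_h 0 = 0`. [folklore] -/
@[simp] theorem fourierSemiclassical_zero_fun (h ξ : ℝ) :
    fourierSemiclassical h (fun _ => 0) ξ = 0 := by
  simp [fourierSemiclassical]

/-- The kernel `e^{-ixξ/h}` is unimodular, so `|𝓕_h f(ξ)| ≤ (2πh)^{-1/2} ‖f‖_{L¹}` — the bound
`‖𝓕_h‖_{L¹→L^∞} = (2πh)^{-1/2}` used in the "volume" uncertainty principle. [cite: Dyatlov2019, §2.1 (2.3)] -/
theorem norm_fourierSemiclassical_le {h : ℝ} (hh : 0 < h) (f : ℝ → ℂ) (ξ : ℝ) :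
    ‖fourierSemiclassical h f ξ‖ ≤ (2 * π * h) ^ (-(1 / 2 : ℝ)) * ∫ x : ℝ, ‖f x‖ := by
  rw [fourierSemiclassical, norm_mul, Complex.norm_real,
    Real.norm_of_nonneg (Real.rpow_nonneg (by positivity) _)]
  refine mul_le_mul_of_nonneg_left ?_ (Real.rpow_nonneg (by positivity) _)
  refine (norm_integral_le_integral_norm _).trans (le_of_eq ?_)
  refine integral_congr_ae (Filter.Eventually.of_forall fun x => ?_)
  have hker : ‖Complex.exp (-(Complex.I * (x : ℂ) * (ξ : ℂ) / (h : ℂ)))‖ = 1 := by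
    rw [Complex.norm_exp]
    have : (-(Complex.I * (x : ℂ) * (ξ : ℂ) / (h : ℂ))).re = 0 := by
      rw [show -(Complex.I * (x : ℂ) * (ξ : ℂ) / (h : ℂ)) = ((-(x * ξ / h) : ℝ) : ℂ) * Complex.I by
        push_cast; ring]
      simp
    rw [this, Real.exp_zero]
  simp only [norm_mul, hker, one_mul]

/-! ## The fractal uncertainty principle for porous sets (named fact) -/

/-- **Fractal uncertainty principle for `ν`-porous sets — NAMED FACT** (Dyatlov–Jin–Nonnenmacher
2021, Proposition 2.9, "a version of [Bourgain–Dyatlov 2018, Theorem 4] adapted to unbounded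
`ν`-porous sets"; Dyatlov 2019, Theorem 3 is the case `X, Y ⊆ [0,1]`). Printed statement: "For each
`ν ∈ (0,1)` there exist `β = β(ν) > 0` and `C = C(ν) > 0` such that the estimate
`‖𝟙_{Ω₋} 𝓕_h 𝟙_{Ω₊}‖_{L²(ℝ)→L²(ℝ)} ≤ C h^β` holds for all `0 < h ≤ 1` and all sets `Ω± ⊆ ℝ` which are
`ν`-porous on scales `h` to `1`." Rendering (see the file header): `Ω₋ = X` (frequency side),
`Ω₊ = Y` (position side), both measurable; the operator-norm bound is stated on the dense class of
`u ∈ L¹(ℝ) ∩ L²(ℝ)` vanishing off `Y`, as `∫_X |𝓕_h u(ξ)|² dξ ≤ (C h^β)² ∫_ℝ |u(x)|² dx` with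
`𝓕_h u(ξ) = (2πh)^{-1/2} ∫ e^{-ixξ/h} u(x) dx` (`fourierSemiclassical`). The proof in print reduces
to Bourgain–Dyatlov's theorem for `δ`-regular sets (`bourgainDyatlov2018_thm4`) by covering porous
sets with `δ(ν)`-regular ones, `δ < 1` (Dyatlov–Jin 2018; Dyatlov 2019, Prop. 1(2)), and almost
orthogonality for unbounded sets. [cite: DyatlovJinNonnenmacher2021, Proposition 2.9] [cite: Dyatlov2019, §2.3 Theorem 3] [cite: BourgainDyatlov2018, Theorem 4] -/
def dyatlovJinNonnenmacher2021_prop_2_9 : Prop :=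
  ∀ ν : ℝ, 0 < ν → ν < 1 → ∃ β : ℝ, 0 < β ∧ ∃ C : ℝ, 0 < C ∧
    ∀ h : ℝ, 0 < h → h ≤ 1 → ∀ X Y : Set ℝ, MeasurableSet X → MeasurableSet Y →
      IsPorousOnScales X ν h 1 → IsPorousOnScales Y ν h 1 →
        ∀ u : ℝ → ℂ, Integrable u → MemLp u 2 volume → (∀ x, x ∉ Y → u x = 0) →
          ∫ ξ in X, ‖fourierSemiclassical h u ξ‖ ^ 2 ≤ (C * h ^ β) ^ 2 * ∫ x, ‖u x‖ ^ 2

/-- **Dyatlov 2019, Theorem 3 (FUP for porous sets in `[0,1]`), from the fact.** "Fix `ν > 0`. Then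
there exists `β = β(ν) > 0` such that `‖𝟙_X 𝓕_h 𝟙_Y‖_{L²→L²} = O(h^β)` as `h → 0` holds for all
`h`-dependent families of sets `X, Y ⊆ [0,1]` which are `ν`-porous on scales `h` to `1`" — here with
the uniform constant of DJN Prop. 2.9, for `ν < 1` (for `ν > 1` there are no such sets at all once
`h < 1`, `IsPorousOnScales.not_of_one_lt`), in the same quadratic-form rendering.
[cite: Dyatlov2019, §2.3 Theorem 3] [cite: DyatlovJinNonnenmacher2021, Proposition 2.9] -/
theorem dyatlov2019_thm3_of (hfup : dyatlovJinNonnenmacher2021_prop_2_9) {ν : ℝ} (hν : 0 < ν)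
    (hν1 : ν < 1) :
    ∃ β : ℝ, 0 < β ∧ ∃ C : ℝ, 0 < C ∧ ∀ h : ℝ, 0 < h → h < 1 →
      ∀ X Y : Set ℝ, X ⊆ Icc 0 1 → Y ⊆ Icc 0 1 → MeasurableSet X → MeasurableSet Y →
        IsPorousOnScales X ν h 1 → IsPorousOnScales Y ν h 1 →
          ∀ u : ℝ → ℂ, Integrable u → MemLp u 2 volume → (∀ x, x ∉ Y → u x = 0) →
            ∫ ξ in X, ‖fourierSemiclassical h u ξ‖ ^ 2 ≤ (C * h ^ β) ^ 2 * ∫ x, ‖u x‖ ^ 2 := by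
  obtain ⟨β, hβ, C, hC, H⟩ := hfup ν hν hν1
  exact ⟨β, hβ, C, hC, fun h hh hh1 X Y _ _ hXm hYm hX hY u hu1 hu2 hu0 =>
    H h hh hh1.le X Y hXm hYm hX hY u hu1 hu2 hu0⟩

end Literature.Analysis.Fourier
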